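import Literature.NumberTheory.EllipticCurves.X049HeckeCoefficients
import Literature.NumberTheory.EllipticCurves.QuadraticOrderEisensteinNumbers
import Literature.NumberTheory.LFunctions.BinaryThetaSeries
import Literature.NumberTheory.EllipticCurves.AnalyticRank
import HarnessLib

/-!
# `L(X₀(49) ⊗ c, s) = 4^{s−1} Θ-L(Ψ_c, s)`: the `L`-series of `49a1` as a weight-one theta `L`-series of `ℤ[½(1+√−7)]`,
# and `L(X₀(49), s)` is entire — modulo the group order formula

Topic `Literature/NumberTheory/EllipticCurves`, namespace `Literature.NumberTheory.EllipticCurves.X049` (sequel to `X049HeckeCoefficients`).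
THEOREMS ONLY.  The `ℤ[½(1+√−7)]`-twin of `SexticTwistThetaDictionary` (`ℤ[ω]`), `QuarticTwistThetaDictionary` (`ℤ[i]`) and
`SqrtTwoTwistThetaDictionary` (`ℤ[√-2]`): Rajwade's «`L_1(s) = Σ_{λ ≡ 1,2,4 (√−7)} λ̄ (Nλ)^{−s}`» (Thm. 4) for `E = X₀(49) = 49a1`,
realised through the tree's weight-one binary theta series of the form `y₁² + 7y₂²` (`LFunctions.BinaryThetaSeries`, Hecke 1920 §9) on
the lattice `2·ℤ[ω] = {(y₁, y₂) : y₁ ≡ y₂ (2)}`, `y = 2γ = (2x + y) + y√−7` for `γ = x + yω` (`QuadOrder.parityLift`).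

* `coeff_parityLift`, `coeff_parityLift_eq_zero`, `lSeries_coeff_parityLift` — the theta coefficients of a weight `Wt` on `ℤ[ω]` lifted to
  `ℤ²`: `Σ_{y₁² + 7y₂² = 4m} Wt♯(y) y₁ = Σ_{N z = m} Wt(z) (2 re z + im z)` and `0` off `4ℕ`; `L`-series `= 4^{−s} Σ_m (…) m^{−s}`;
* `weight_periodic` — `Wt_c(z) = chi z · c(N z)` is periodic modulo `7m₀` (`c : ℤ/m₀ → ℂ`);
* `sum_normEq_weight` — `Σ_{N z = m} Wt_c(z)(2 re z + im z) = 4 c(m) a_m(E)` (Rajwade's Thm. 4 via `sum_normEq_chi_mul_trace`);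
* ★ `lSeries_twist_eq_thetaLFunction` — **`Σ_m c(m) a_m(E) m^{−s} = 4^{s−1} · Θ-L_{14m₀}(Wt_c♯)(s)`** for `Re s > 3/2`, whence
  `exists_differentiable_twist` (an entire continuation of every periodic twist) and
* ★ `hasEntireLFunction` — **`L(49a1, s)` is entire** (`WeierstrassCurve.HasEntireLFunction`), MODULO `groupOrder_A7` (Silverberg 2010
  (2.1): the sign of `a_p` at the split primes), instead of the Deuring–Hecke leaf `hasEntireLFunction_of_j_mem_maximalCMJInvariants`
  (Silverman *Advanced Topics* II.10.5.1) or modularity.  Nothing about BSD is proved here.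

## References
* A. R. Rajwade, J. Austral. Math. Soc. A 24 (1977), Thm. 4 and Thm. 6. [Rajwade1977]
* E. Hecke, Math. Z. 6 (1920), §9. [Hecke1920]
* N. Koblitz, *Introduction to Elliptic Curves and Modular Forms*, Ch. II §5 (theta series with Grössencharacter, entire). [KoblitzECMF1993]
* J. H. Silverman, *Advanced Topics in the Arithmetic of Elliptic Curves* (1994), II Cor. 10.5.1. [SilvermanATAEC1994]

## Mathlib / tree search
Tree: `BinaryTheta.{qf, qfEq, mem_qfEq, wt, coeff, thetaLFunction, thetaLFunction_eq_LSeries, differentiable_thetaLFunction}`,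
`QuadOrder.{parityLift, parityLift_periodic}`, `X049.sum_normEq_chi_mul_trace`, `OmegaNegSeven.{normEq, mem_normEq, four_mul_norm, norm_mk',
chi_mk, jacobiSym_seven_eq_of_emod_eq}`, `WeierstrassCurve.HasEntireLFunction`.  Mathlib: `LSeries`, `LSeries_congr`, `LSeries.term_of_ne_zero`.
-/

noncomputable section

open scoped Classical

namespace Literature.NumberTheory.EllipticCurves

namespace X049

open _root_.WeierstrassCurve QuadraticAlgebra Complex Literature.NumberTheory.LFunctions Literature.NumberTheory.QuadraticFields
  Literature.NumberTheory.QuadraticFields.OmegaNegSeven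

/-! ### §1 The lattice `2ℤ[ω] ⊂ ℤ²`: theta coefficients of a lifted weight -/

/-- `(2x + y)² + 7y² = 4 N(x + yω)`. [cite: Hecke1920, §9] -/
theorem qf_coords (x y : ℤ) : BinaryTheta.qf 7 (2 * x + y, y) = 4 * (x ^ 2 + x * y + 2 * y ^ 2) := by
  simp only [BinaryTheta.qf]; push_cast; ring

/-- **The theta coefficients at `4m`**: for any weight `Wt : ℤ[ω] → ℂ`, lifted to `ℤ²` by `Wt♯(y) = Wt((y₁ − y₂)/2 + y₂ω)` on
`y₁ ≡ y₂ (2)` (`QuadOrder.parityLift`), `Σ_{y₁² + 7y₂² = 4m} Wt♯(y) y₁ = Σ_{N z = m} Wt(z) (2 re z + im z)` (`y = (2 re z + im z, im z)`).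
[cite: Hecke1920, §9] [cite: Rajwade1977, Thm 4] -/
theorem coeff_parityLift (Wt : QuadraticAlgebra ℤ (-2) 1 → ℂ) (m : ℕ) :
    BinaryTheta.coeff 7 1 0 (QuadOrder.parityLift fun d : ℤ × ℤ ↦ Wt ⟨d.1, d.2⟩) (4 * m) =
      ∑ z ∈ normEq m, Wt z * ((2 * z.re + z.im : ℤ) : ℂ) := by
  rw [BinaryTheta.coeff]
  -- restrict to `y₁ ≡ y₂ (2)`
  rw [← Finset.sum_filter_add_sum_filter_not (BinaryTheta.qfEq 7 (4 * m)) (fun y : ℤ × ℤ ↦ (2 : ℤ) ∣ y.1 - y.2)]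
  have hzero : ∑ y ∈ (BinaryTheta.qfEq 7 (4 * m)).filter (fun y : ℤ × ℤ ↦ ¬ (2 : ℤ) ∣ y.1 - y.2),
      QuadOrder.parityLift (fun d : ℤ × ℤ ↦ Wt ⟨d.1, d.2⟩) y * BinaryTheta.wt 1 0 y = 0 := by
    refine Finset.sum_eq_zero fun y hy ↦ ?_
    rw [Finset.mem_filter] at hy
    rw [QuadOrder.parityLift, if_neg hy.2, zero_mul]
  rw [hzero, add_zero]
  symm
  refine Finset.sum_nbij' (fun z : QuadraticAlgebra ℤ (-2) 1 ↦ (2 * z.re + z.im, z.im))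
    (fun y : ℤ × ℤ ↦ (⟨(y.1 - y.2) / 2, y.2⟩ : QuadraticAlgebra ℤ (-2) 1)) ?_ ?_ ?_ ?_ ?_
  · intro z hz
    rw [mem_normEq] at hz
    rw [Finset.mem_filter, BinaryTheta.mem_qfEq]
    refine ⟨?_, ⟨z.re, by ring⟩⟩
    have h4 := four_mul_norm z
    rw [hz] at h4
    simp only [BinaryTheta.qf]
    push_cast
    linarith
  · intro y hy
    rw [Finset.mem_filter, BinaryTheta.mem_qfEq] at hy
    obtain ⟨hq, t, ht⟩ := hy
    rw [mem_normEq]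
    have h1 : (y.1 - y.2) / 2 = t := by rw [ht]; simp
    rw [h1, norm_mk']
    have hy1 : y.1 = 2 * t + y.2 := by linarith
    have hq' : BinaryTheta.qf 7 y = 4 * m := by exact_mod_cast hq
    simp only [BinaryTheta.qf, hy1] at hq'
    push_cast at hq'
    linarith
  · intro z hz
    ext <;> simp
  · intro y hy
    rw [Finset.mem_filter] at hy
    obtain ⟨-, t, ht⟩ := hy
    have h1 : (y.1 - y.2) / 2 = t := by rw [ht]; simp
    ext
    · simp only [h1]; linarith
    · rfl
  · intro z hz
    simp only [QuadOrder.parityLift, BinaryTheta.wt]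
    have hpar : (2 : ℤ) ∣ 2 * z.re + z.im - z.im := ⟨z.re, by ring⟩
    rw [if_pos hpar, show (2 * z.re + z.im - z.im) / 2 = z.re by
      rw [show 2 * z.re + z.im - z.im = 2 * z.re by ring]; simp]
    push_cast
    ring

/-- **The theta coefficients vanish off the multiples of `4`** (`y₁ ≡ y₂ (2)` forces `4 ∣ y₁² + 7y₂²`). [cite: Hecke1920, §9] -/
theorem coeff_parityLift_eq_zero (Wt : QuadraticAlgebra ℤ (-2) 1 → ℂ) {m' : ℕ} (hm : ¬ 4 ∣ m') :
    BinaryTheta.coeff 7 1 0 (QuadOrder.parityLift fun d : ℤ × ℤ ↦ Wt ⟨d.1, d.2⟩) m' = 0 := by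
  rw [BinaryTheta.coeff]
  refine Finset.sum_eq_zero fun y hy ↦ ?_
  rw [BinaryTheta.mem_qfEq] at hy
  rw [QuadOrder.parityLift]
  split_ifs with hpar
  · exfalso
    apply hm
    obtain ⟨t, ht⟩ := hpar
    have hy1 : y.1 = 2 * t + y.2 := by linarith
    have h4 : (4 : ℤ) ∣ (m' : ℤ) := by
      rw [← hy]; simp only [BinaryTheta.qf, hy1]; exact ⟨t ^ 2 + t * y.2 + 2 * y.2 ^ 2, by ring⟩
    exact_mod_cast h4
  · rw [zero_mul]

/-- **The `L`-series of the lifted theta coefficients is `4^{-s} · Σ_m (Σ_{N z = m} Wt(z)(2 re z + im z)) m^{-s}`** (the coefficients live on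
`4ℕ`). [cite: Hecke1920, §9] -/
theorem lSeries_coeff_parityLift (Wt : QuadraticAlgebra ℤ (-2) 1 → ℂ) (s : ℂ) :
    LSeries (BinaryTheta.coeff 7 1 0 (QuadOrder.parityLift fun d : ℤ × ℤ ↦ Wt ⟨d.1, d.2⟩)) s =
      (4 : ℂ) ^ (-s) * LSeries (fun m : ℕ ↦ ∑ z ∈ normEq m, Wt z * ((2 * z.re + z.im : ℤ) : ℂ)) s := by
  set f := BinaryTheta.coeff 7 1 0 (QuadOrder.parityLift fun d : ℤ × ℤ ↦ Wt ⟨d.1, d.2⟩) with hf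
  set g : ℕ → ℂ := fun m : ℕ ↦ ∑ z ∈ normEq m, Wt z * ((2 * z.re + z.im : ℤ) : ℂ) with hg
  have hsupp : Function.support (LSeries.term f s) ⊆ Set.range (fun n : ℕ ↦ 4 * n) := by
    intro m' hm'
    rw [Function.mem_support] at hm'
    by_contra hrange
    apply hm'
    have h4 : ¬ 4 ∣ m' := fun ⟨t, ht⟩ ↦ hrange ⟨t, ht.symm⟩
    rcases eq_or_ne m' 0 with rfl | h0
    · exact LSeries.term_zero _ _
    · rw [LSeries.term_of_ne_zero h0, hf, coeff_parityLift_eq_zero Wt h4, zero_div]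
  rw [LSeries, ← (mul_right_injective₀ (show (4 : ℕ) ≠ 0 by norm_num)).tsum_eq hsupp, LSeries, ← tsum_mul_left]
  refine tsum_congr fun n ↦ ?_
  rcases eq_or_ne n 0 with rfl | hn
  · simp [LSeries.term_zero]
  · have h4n : 4 * n ≠ 0 := by omega
    have hc : f (4 * n) = g n := coeff_parityLift Wt n
    rw [LSeries.term_of_ne_zero h4n, LSeries.term_of_ne_zero hn, hc, Nat.cast_mul, Complex.natCast_mul_natCast_cpow, Complex.cpow_neg]
    simp only [Nat.cast_ofNat]
    have h4s : (4 : ℂ) ^ s ≠ 0 := by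
      rw [Ne, cpow_eq_zero_iff, not_and_or]; exact Or.inl (by norm_num)
    have hns : (n : ℂ) ^ s ≠ 0 := by
      rw [Ne, cpow_eq_zero_iff, not_and_or]; exact Or.inl (by exact_mod_cast hn)
    field_simp

/-! ### §2 The weight `Wt_c(z) = chi z · c(N z)`: periodicity modulo `7m₀` and its norm sums -/

/-- `N(z + Mw) ≡ N z (mod M)`. [cite: Hecke1920, §9] -/
theorem norm_add_mul (M : ℤ) (x y a b : ℤ) :
    (⟨x + M * a, y + M * b⟩ : QuadraticAlgebra ℤ (-2) 1).norm =
      (⟨x, y⟩ : QuadraticAlgebra ℤ (-2) 1).norm + M * (2 * x * a + M * a ^ 2 + x * b + y * a + M * a * b + 4 * y * b + 2 * M * b ^ 2) := by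
  rw [norm_mk', norm_mk']; ring

/-- **`Wt_c(z) = chi z · c(N z mod m₀)` is periodic modulo `7m₀`** in the coordinates `z = x + yω` (`chi` depends on `2x + y mod 7`,
`N z mod m₀` on `z mod m₀`). [cite: Hecke1920, §9] [cite: Rajwade1977, Thm 5 and Thm 6] -/
theorem weight_periodic (m₀ : ℕ) (c : ZMod m₀ → ℂ) (d w : ℤ × ℤ) :
    (fun d : ℤ × ℤ ↦ (chi (⟨d.1, d.2⟩ : QuadraticAlgebra ℤ (-2) 1) : ℂ) *
        c (((⟨d.1, d.2⟩ : QuadraticAlgebra ℤ (-2) 1).norm : ℤ) : ZMod m₀)) (d.1 + (7 * m₀ : ℕ) * w.1, d.2 + (7 * m₀ : ℕ) * w.2) =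
      (fun d : ℤ × ℤ ↦ (chi (⟨d.1, d.2⟩ : QuadraticAlgebra ℤ (-2) 1) : ℂ) *
        c (((⟨d.1, d.2⟩ : QuadraticAlgebra ℤ (-2) 1).norm : ℤ) : ZMod m₀)) d := by
  simp only
  congr 1
  · -- `chi` is `7`-periodic
    rw [chi_mk, chi_mk]
    congr 1
    apply jacobiSym_seven_eq_of_emod_eq
    have : 2 * (d.1 + (7 * m₀ : ℕ) * w.1) + (d.2 + (7 * m₀ : ℕ) * w.2) = 2 * d.1 + d.2 + 7 * (m₀ * (2 * w.1 + w.2)) := by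
      push_cast; ring
    rw [this, Int.add_mul_emod_self_left]
  · -- the norm is `m₀`-periodic
    congr 1
    rw [show ((7 * m₀ : ℕ) : ℤ) = (7 * m₀ : ℤ) by push_cast; ring, norm_add_mul]
    push_cast
    rw [ZMod.natCast_self]
    ring

/-- **`Σ_{N z = m} Wt_c(z)(2 re z + im z) = 4 c(m) a_m(E)`** (mod `groupOrder_A7`): on `N z = m` the weight is `c(m) chi z`, and
`Σ_{N z = m} chi z (2 re z + im z) = 4 a_m` (`sum_normEq_chi_mul_trace`, Rajwade's Thm. 4). [cite: Rajwade1977, Thm 4] -/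
theorem sum_normEq_weight (hG : groupOrder_A7) (m₀ : ℕ) (c : ZMod m₀ → ℂ) (m : ℕ) :
    ∑ z ∈ normEq m, (fun d : ℤ × ℤ ↦ (chi (⟨d.1, d.2⟩ : QuadraticAlgebra ℤ (-2) 1) : ℂ) *
        c (((⟨d.1, d.2⟩ : QuadraticAlgebra ℤ (-2) 1).norm : ℤ) : ZMod m₀)) (z.re, z.im) * ((2 * z.re + z.im : ℤ) : ℂ) =
      4 * c (m : ZMod m₀) * ((E.map (Int.castRingHom ℚ)).LFunction m : ℂ) := by
  have hkey := sum_normEq_chi_mul_trace hG m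
  have hcast : ((∑ z ∈ normEq m, chi z * (2 * z.re + z.im) : ℤ) : ℂ) = 4 * ((E.map (Int.castRingHom ℚ)).LFunction m : ℂ) := by
    rw [hkey]; push_cast; ring
  rw [Int.cast_sum] at hcast
  have hterm : ∀ z ∈ normEq m, (fun d : ℤ × ℤ ↦ (chi (⟨d.1, d.2⟩ : QuadraticAlgebra ℤ (-2) 1) : ℂ) *
      c (((⟨d.1, d.2⟩ : QuadraticAlgebra ℤ (-2) 1).norm : ℤ) : ZMod m₀)) (z.re, z.im) * ((2 * z.re + z.im : ℤ) : ℂ) =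
      c (m : ZMod m₀) * ((chi z * (2 * z.re + z.im) : ℤ) : ℂ) := by
    intro z hz
    have hzm : z.norm = m := mem_normEq.mp hz
    have hz' : (⟨z.re, z.im⟩ : QuadraticAlgebra ℤ (-2) 1) = z := rfl
    simp only [hz', hzm, Int.cast_natCast]
    push_cast
    ring
  rw [Finset.sum_congr rfl hterm, ← Finset.mul_sum, hcast]
  ring

/-! ### §3 The `L`-series identity and the entire continuation -/

/-- **Rajwade's Theorem 4 with Hecke's continuation, for `X₀(49)`: `Σ_m c(m) a_m(E) m^{−s} = 4^{s−1} · Θ-L_{14m₀}(Wt_c♯)(s)`** for `Re s > 3/2`,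
where `Wt_c♯ = parityLift (d ↦ chi(d₁ + d₂ω) c(N(d₁ + d₂ω)))` on `ℤ²` and `Θ-L = BinaryTheta.thetaLFunction 7 (14m₀) 1 0` is the entire
weight-one theta `L`-function of the form `y₁² + 7y₂²` (modulo `groupOrder_A7`; any `c : ℤ/m₀ → ℂ`, `m₀ ≥ 1`).
[cite: Rajwade1977, Thm 4 and Thm 6] [cite: Hecke1920, §9] [cite: KoblitzECMF1993, Ch. II §5, Theorem (proof)] -/
theorem lSeries_twist_eq_thetaLFunction (hG : groupOrder_A7) (m₀ : ℕ) [NeZero m₀] (c : ZMod m₀ → ℂ) {s : ℂ} (hs : 3 / 2 < s.re) :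
    haveI : NeZero (2 * (7 * m₀)) := ⟨Nat.mul_ne_zero two_ne_zero (Nat.mul_ne_zero (by norm_num) (NeZero.ne m₀))⟩
    LSeries (fun m : ℕ ↦ c (m : ZMod m₀) * ((E.map (Int.castRingHom ℚ)).LFunction m : ℂ)) s =
      (4 : ℂ) ^ s / 4 * BinaryTheta.thetaLFunction 7 (2 * (7 * m₀)) 1 0
        (QuadOrder.parityLift fun d : ℤ × ℤ ↦ (chi (⟨d.1, d.2⟩ : QuadraticAlgebra ℤ (-2) 1) : ℂ) *
          c (((⟨d.1, d.2⟩ : QuadraticAlgebra ℤ (-2) 1).norm : ℤ) : ZMod m₀)) s := by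
  haveI : NeZero (2 * (7 * m₀)) := ⟨Nat.mul_ne_zero two_ne_zero (Nat.mul_ne_zero (by norm_num) (NeZero.ne m₀))⟩
  set Φ : ℤ × ℤ → ℂ := fun d : ℤ × ℤ ↦ (chi (⟨d.1, d.2⟩ : QuadraticAlgebra ℤ (-2) 1) : ℂ) *
    c (((⟨d.1, d.2⟩ : QuadraticAlgebra ℤ (-2) 1).norm : ℤ) : ZMod m₀) with hΦ
  have hper : ∀ d w : ℤ × ℤ, Φ (d.1 + (7 * m₀ : ℕ) * w.1, d.2 + (7 * m₀ : ℕ) * w.2) = Φ d := weight_periodic m₀ c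
  rw [BinaryTheta.thetaLFunction_eq_LSeries 7 (2 * (7 * m₀)) 1 0 (QuadOrder.parityLift Φ)
      (QuadOrder.parityLift_periodic (7 * m₀) Φ hper) hs,
    show (QuadOrder.parityLift Φ) = QuadOrder.parityLift (fun d : ℤ × ℤ ↦ (fun z : QuadraticAlgebra ℤ (-2) 1 ↦ Φ (z.re, z.im)) ⟨d.1, d.2⟩)
      from rfl,
    lSeries_coeff_parityLift (fun z : QuadraticAlgebra ℤ (-2) 1 ↦ Φ (z.re, z.im)) s,
    LSeries_congr (fun {m} _ ↦ sum_normEq_weight hG m₀ c m) s]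
  have h4 : LSeries (fun m : ℕ ↦ 4 * c (m : ZMod m₀) * ((E.map (Int.castRingHom ℚ)).LFunction m : ℂ)) s =
      4 * LSeries (fun m : ℕ ↦ c (m : ZMod m₀) * ((E.map (Int.castRingHom ℚ)).LFunction m : ℂ)) s := by
    rw [← LSeries_smul]
    congr 1
    funext m
    simp only [Pi.smul_apply, smul_eq_mul]
    ring
  rw [h4]
  have h4s : (4 : ℂ) ^ s ≠ 0 := by
    rw [Ne, cpow_eq_zero_iff, not_and_or]; exact Or.inl (by norm_num)
  rw [cpow_neg]
  field_simp

/-- **Hecke's continuation for `L(X₀(49) ⊗ c, s)`**: `Σ_m c(m) a_m(E) m^{−s}` is the restriction to `Re s > 3/2` of an entire function,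
for every `c : ℤ/m₀ → ℂ` (modulo `groupOrder_A7`). [cite: Rajwade1977, Thm 6] [cite: Hecke1920, §9] -/
theorem exists_differentiable_twist (hG : groupOrder_A7) (m₀ : ℕ) [NeZero m₀] (c : ZMod m₀ → ℂ) :
    ∃ L : ℂ → ℂ, Differentiable ℂ L ∧ ∀ s : ℂ, 3 / 2 < s.re →
      L s = LSeries (fun m : ℕ ↦ c (m : ZMod m₀) * ((E.map (Int.castRingHom ℚ)).LFunction m : ℂ)) s := by
  haveI : NeZero (2 * (7 * m₀)) := ⟨Nat.mul_ne_zero two_ne_zero (Nat.mul_ne_zero (by norm_num) (NeZero.ne m₀))⟩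
  refine ⟨fun s ↦ (4 : ℂ) ^ s / 4 * BinaryTheta.thetaLFunction 7 (2 * (7 * m₀)) 1 0
      (QuadOrder.parityLift fun d : ℤ × ℤ ↦ (chi (⟨d.1, d.2⟩ : QuadraticAlgebra ℤ (-2) 1) : ℂ) *
        c (((⟨d.1, d.2⟩ : QuadraticAlgebra ℤ (-2) 1).norm : ℤ) : ZMod m₀)) s, ?_,
    fun s hs ↦ (lSeries_twist_eq_thetaLFunction hG m₀ c hs).symm⟩
  refine Differentiable.mul (Differentiable.div_const (fun s ↦ ?_) 4) (BinaryTheta.differentiable_thetaLFunction 7 (2 * (7 * m₀)) 1 0 _)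
  exact differentiableAt_id.const_cpow (Or.inl (by norm_num))

/-- ★ **`L(X₀(49), s)` is entire**, modulo the group order formula `groupOrder_A7` (Silverberg 2010 (2.1) = Rajwade 1977 Thm. 3): the
Weierstrass curve `49a1 : y² + xy = x³ − x² − 2x − 1` over `ℚ` satisfies `WeierstrassCurve.HasEntireLFunction` — the untwisted case
`m₀ = 1`, `c = 1` of the dictionary.  This discharges the Deuring–Hecke leaf `hasEntireLFunction_of_j_mem_maximalCMJInvariants` at
`j = −3375` by Hecke's theta series instead of CM theory or modularity. [cite: Rajwade1977, Thm 4 and Thm 6] [cite: Hecke1920, §9]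
[cite: SilvermanATAEC1994, II Cor. 10.5.1] -/
theorem hasEntireLFunction (hG : groupOrder_A7) : (E.map (Int.castRingHom ℚ)).HasEntireLFunction := by
  obtain ⟨L, hL, hLs⟩ := exists_differentiable_twist hG 1 (fun _ ↦ (1 : ℂ))
  refine ⟨L, hL, fun s hs ↦ ?_⟩
  rw [hLs s hs, WeierstrassCurve.LSeries]
  exact LSeries_congr (fun {m} _ ↦ by simp) s

/-- The same for the literal `ℚ`-model `⟨1, −1, 0, −2, −1⟩`. [cite: Rajwade1977, Thm 6] [cite: SilvermanATAEC1994, II Cor. 10.5.1] -/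
theorem hasEntireLFunction' (hG : groupOrder_A7) : (⟨1, -1, 0, -2, -1⟩ : WeierstrassCurve ℚ).HasEntireLFunction := by
  rw [← map_E]; exact hasEntireLFunction hG

end X049

end Literature.NumberTheory.EllipticCurves

end
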